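import Literature.MathematicalPhysics.QuantumFieldTheory.Balaban1983to89.B8Eq1115Concrete
import Literature.MathematicalPhysics.QuantumFieldTheory.Balaban1983to89.B8Eq1122Concrete

/-!
# `Balaban1983to89.B8Eq1122Local` — [Balaban1985RegularSpaces] Sect. E pp. 96–97: the Lipschitz bound of (1.122)/(1.125)
# «|C′(λ − H′X₁) − C′(λ − H′X₂)| ≦ C′₂2B′₀(α₃ + α₄)|X₁ − X₂|» FOR THE CONCRETE REMAINDER `C′ = C′_m(u₁, ·)` OF (213) [3]
# WITH LOCAL HYPOTHESES on the block tower `Bʲ(y)` only (the inductive `u₁` of Theorem 4, general background) — the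
# region-dependent form «on Ω_j» that p05's one-level `B8Eq1122Concrete.lipschitz1122` lists as NOT CLAIMED

statement-level skeleton of published theorems with citation tags; proofs where landed; nothing here is a claim about the Yang–Mills mass gap

T. Bałaban, *Spaces of regular gauge field configurations on a lattice and gauge fixing conditions*, Commun.
Math. Phys. **99** (1985) 75–102 `[Balaban1985RegularSpaces]` ("B8"; printed page = PDF page + 74), pp. 95–97 [PDF 21–23];
[3] = T. Bałaban, *Averaging operations for lattice gauge theories*, Commun. Math. Phys. **98** (1985) 17–51
`[Balaban1985Averaging]`, Prop. 10 (203)–(214) p. 50.  PDF held: `paper:balaban1985-cmp99-regular-spaces-gauge-fixing`.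
STATUS: published, refereed.

CITATION HEADER (lean-in-tree rule).  Cell `pub-ymgap` (YM Track A, DAG node N05 = [B8], HUMAN RULING D-0062), seat
`pub-ymgap-dag-n05-b`, gen 0; dag-lead assignment «Thm 4 chain, Sect. E pp. 95–97 at k levels» (display split with seat
`pub-ymgap-dag-n04-b`, who holds (1.68)–(1.115)).  WHAT IS REPRODUCED = SKELETON row **B8.Eq1.125** / **B8.Eq1.122** (the Lipschitz
sentence of p. 97) in the REGION-DEPENDENT form: the tree's `B8Eq1122Concrete.lipschitz1122` (p05) proves it from GLOBAL one-level
hypotheses (`pdev U₀ < α₀L^{−2k}` on all of `ℤᵈ`, (1.119) for `μ₁, μ₂` at every site with the weight `L⁻ᵏ`, `u₁ ∈ Λ_k(U₀, α₃)`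
globally; its READING (a) «ONE-LEVEL (207)-domain»), whereas Theorem 4's induction (pp. 88–97) uses it for the inductive `u₁` on
`Bʲ(Λ_j)` with the data of the `j`-block tower only and the `Ω_j`-scale `L^{−j}`.  This file supplies that localisation by the device
of `B8Eq1115Concrete.eq214_local` (dag-n04-b; itself the localisation of (213)–(214)): clamped extension of the background
(`B7Prop1Local.clampCfg`), zero extension of the field `B` (`B7Prop3Flat.insCfg ∘ B7Prop5Flat.restr`), clamped site functions
`μ ∘ π`, the global theorem for them with `k ↦ j`, transfer back by the tower-locality of `ũ′ᵐ`, `Q′_m` and of [3]'s gauge fixing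
(`B8Eq1115Concrete.utilG_congr_tower` / `lamAvgG_congr_tower`, `B8Ineq172Concrete.glev_congr_tower`).  Kind «kernel-checked proof»,
theorems only: no `def`, no `… : Prop` fact, no existing module modified.  REUSED BY NAME (nothing restated):
`B8Eq1122Concrete.lipschitz1122`, `B8Eq1123Concrete.Cnl`, `B8Eq178Averages.{Qnl_eq_mlog_utilG, qprimeIter_bgT_eq_lamAvgG}`,
`B7Eq167General.inLambda_glev_general`, `B8Eq1115Concrete.{utilG_congr_tower, lamAvgG_congr_tower}`, `B8Ineq172Concrete.glev_congr_tower`,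
`B7Prop1Local.{clamp, clampCfg, clamp_inBox, clamp_of_inBox, clamp_add_e_of, clamp_add_e_of_not, clampCfg_mem, clampCfg_agree,
pdev_clampCfg_le}`, `B8Ineq130.{tlo, thi, tlo_le_thi, inBox_of_le}`, `B7Prop5Flat.{bondsIn, restr, insCfg_restr_of_mem, mem_bondsIn,
agreeOn_insCfg_restr, agreeOn_expCfg}`.

## THE PRINTED TEXT (pp. 96–97 [PDF 22–23])

«C′(λ − H′X₁) − C′(λ − H′X₂) = ∫₀¹ dt ⟨(δ/δλ)C′(λ − tH′X₁ − (1 − t)H′X₂), H′X₂ − H′X₁⟩, (1.122) … |⟨(δ/δλ)C′(λ), λ₀⟩| ≦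
r⁻¹ sup_{|τ|=r}|C′(λ + τλ₀)| < C′₂(α₃ + α₄)α₄ α₄⁻¹ 2max{|λ₀|, |Dλ₀|} = C′₂2(α₃ + α₄)max{|λ₀|, |Dλ₀|}. (1.125)  Applying it to the
expression (1.122) we have |C′(λ − H′X₁) − C′(λ − H′X₂)| ≦ C′₂2B′₀(α₃ + α₄)|X₁ − X₂|»; the setting (p. 96): «|λ| < ½α₄,
|Dλ| < ½α₄(Lʲη)⁻¹ on Ω_j, … (1.119)»; p. 89: the inductive `u₁` «is determined uniquely in terms of U₁ and is given by (106)» of [3],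
with (1.69) «|A| < B₁(α₀ + α₁)(Lʲη)⁻¹ on Ω_j».

## WHAT IS CERTIFIED HERE (kernel; axioms `propext` / `Classical.choice` / `Quot.sound`)

Setting = `B8Eq1115Concrete`'s: `L ≥ 2`, `G ⊂ U1` averaging-closed, `U₀` `G`-valued and regular ON THE FINE BLOCK `Bʲ(y)` ONLY
(`sup_{p ⊂ Bʲ(y)}|U₀(∂p) − 1| < α₀L^{−2j}`, (1.33) at level `j`), `U₁ = e^{B}` with (1.69) `|B_b| ≤ cL^{−j}` on the bonds of `Bʲ(y)`,
`u₁ = glev … j 0` THE gauge transformation (104)–(106) of [3] at top level `j` (B8's inductive `u₁` on `Bʲ(Λ_j)`), two site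
functions `μ₁, μ₂` («λ − H′Xᵢ») in the half-size set (1.119) ON `Bʲ(y)` ONLY (`‖μᵢ(x)‖ < ½α₄`, `‖R(U₀(b))μᵢ(b₊) − μᵢ(b₋)‖ <
½α₄L^{−j}`) whose difference has modulus `m` there (`‖(μ₁ − μ₂)(x)‖ ≤ m`, `‖R(U₀(b))(μ₁ − μ₂)(b₊) − (μ₁ − μ₂)(b₋)‖ ≤ mL^{−j}`).
* **`lipschitz1122_local`** — at every level-`m′` site `z` of the block `Bⁿ(y)` (`n + m′ = j`):
  `‖C′_{m′}(u₁, μ₁)(z) − C′_{m′}(u₁, μ₂)(z)‖ ≤ C′₂·2m·(α₃ + α₄)·L^{m′}L^{−j}` with `α₃ = 40d·c` (`C′₂ = B8Ineq125Concrete.C2p d`),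
  every smallness condition a condition on `α₀`, `c`, `α₄` ALONE (no `j`) — print's «on Ω_j» form of the Lipschitz sentence.

## HONEST SCOPE / LOCATED READING — what is NOT claimed

(i) Constants, windows and the `½α₄` / `2α₄` bookkeeping are EXACTLY `lipschitz1122`'s (its READINGS (a)–(f); cell GAPS G-B8-17); only
the quantifiers of the hypotheses shrink to the tower.  (ii) `u₁` = the constructed `glev` at top level `j` on the tower (as in
`B8Eq1115Concrete`/`B8Ineq172Concrete`); the identification with (106) on `Bʲ(Λ_j)` for the multi-domain axial gauge is dag-n04-b's lane.
(iii) `H′` does not appear: print's instance `μᵢ = λ − H′Xᵢ`, `m = B′₀|X₁ − X₂|` is left to the consumer ((1.120), interface I-B8-2).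
(iv) `ℤᵈ` carriers, `η`-units of the lineage (`L^{−j}` = `(Lʲη)⁻¹·η`), `≤` outputs; the extension device is the tree's, not print's.
NOT HERE: (1.117)/(1.118) at `k` levels, (1.121) summed over `Λ_j`, `D′`, the onto sentence — the next modules of this series.
Nothing here is progress on the summit.
-/

noncomputable section

open NormedSpace Finset

namespace Literature.MathematicalPhysics.QuantumFieldTheory.Balaban1983to89.B8Eq1122Local

open B7Prop1Explicit B7Prop2Explicit B7Prop3Flat B7Prop1Local B7Eq167Flat B7Eq167General
open MatrixLog (mlog)
open B7Eq170Flat (cj cj_apply)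
open B7Prop10General (C6 C4G)
open B7Eq214General (Cgen)
open B7Prop5Flat (bondsIn restr)
open B8Ineq130 (tlo thi inBox_of_le)
open B7Eq84Concrete (glev)
open B8Ineq172Concrete (glev_congr_tower)
open B8Eq1115Concrete (utilG_congr_tower lamAvgG_congr_tower)
open B8Eq178Averages (Qnl_eq_mlog_utilG qprimeIter_bgT_eq_lamAvgG)
open B8Eq1123Concrete (Cnl)
open B8Ineq125Concrete (C2p)
open B8Eq1122Concrete (lipschitz1122)

-- `Site` alone could resolve to the torus sites of `Setup.lean`; re-export the `ℤ^d` sites of `B7Prop1Explicit`.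
export B7Prop1Explicit (Site)

variable {d : ℕ}

/-! ## §1 The clamped site functions and the global (1.119)-type hypotheses from the local ones -/

section Clamp

variable {𝔸 : Type*} [NormedRing 𝔸] [NormedAlgebra ℂ 𝔸] [CompleteSpace 𝔸]
variable {lo hi : Site d} {V : Site d → Fin d → 𝔸ˣ} {lam : Site d → 𝔸} {α β : ℝ}

omit [NormedRing 𝔸] [NormedAlgebra ℂ 𝔸] [CompleteSpace 𝔸] in
/-- `λ ∘ π = λ` on the box (device, not in print). [folklore] -/
private theorem lam_clamp_eq {x : Site d} (hx : InBox lo hi x) : lam (clamp lo hi x) = lam x := by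
  rw [clamp_of_inBox hx]

omit [NormedAlgebra ℂ 𝔸] [CompleteSpace 𝔸] in
/-- «`|λ(x)| < α`» for `λ ∘ π` everywhere from the same on the box. [folklore] -/
private theorem hb_clamp (hlohi : ∀ i, lo i ≤ hi i) (h : ∀ x : Site d, InBox lo hi x → ‖lam x‖ < α) (x : Site d) :
    ‖lam (clamp lo hi x)‖ < α :=
  h _ (clamp_inBox hlohi x)

omit [NormedAlgebra ℂ 𝔸] [CompleteSpace 𝔸] in
/-- «`|λ(x)| ≤ α`» for `λ ∘ π` everywhere from the same on the box. [folklore] -/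
private theorem hb_clamp_le (hlohi : ∀ i, lo i ≤ hi i) (h : ∀ x : Site d, InBox lo hi x → ‖lam x‖ ≤ α) (x : Site d) :
    ‖lam (clamp lo hi x)‖ ≤ α :=
  h _ (clamp_inBox hlohi x)

omit [NormedAlgebra ℂ 𝔸] [CompleteSpace 𝔸] in
/-- «`|R(V(b))λ(b₊) − λ(b₋)| < β`» for `λ ∘ π` w.r.t. the CLAMPED background everywhere, from the same on the bonds of the box (on a
degenerate bond the transport is `1` and the two values coincide). [folklore] -/
private theorem ha_clamp (hlohi : ∀ i, lo i ≤ hi i) (hβ : 0 < β)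
    (h : ∀ (x : Site d) (κ : Fin d), InBox lo hi x → InBox lo hi (x + e κ) → ‖cj (V x κ) (lam (x + e κ)) - lam x‖ < β)
    (x : Site d) (κ : Fin d) :
    ‖cj (clampCfg lo hi V x κ) (lam (clamp lo hi (x + e κ))) - lam (clamp lo hi x)‖ < β := by
  by_cases hP : lo κ ≤ x κ ∧ x κ < hi κ
  · have hx := clamp_inBox hlohi x
    have hxe : InBox lo hi (clamp lo hi x + e κ) := by rw [← clamp_add_e_of hP]; exact clamp_inBox hlohi _
    simp only [clampCfg, hP, and_self, if_true, clamp_add_e_of hP]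
    exact h _ κ hx hxe
  · simp only [clampCfg, hP, if_false, clamp_add_e_of_not (hlohi κ) hP, cj_apply, Units.val_one, inv_one, one_mul,
      mul_one, sub_self, norm_zero]
    exact hβ

omit [NormedAlgebra ℂ 𝔸] [CompleteSpace 𝔸] in
/-- The `≤`-version of `ha_clamp` (for the modulus `m ≥ 0` of a difference). [folklore] -/
private theorem ha_clamp_le (hlohi : ∀ i, lo i ≤ hi i) (hβ : 0 ≤ β)
    (h : ∀ (x : Site d) (κ : Fin d), InBox lo hi x → InBox lo hi (x + e κ) → ‖cj (V x κ) (lam (x + e κ)) - lam x‖ ≤ β)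
    (x : Site d) (κ : Fin d) :
    ‖cj (clampCfg lo hi V x κ) (lam (clamp lo hi (x + e κ))) - lam (clamp lo hi x)‖ ≤ β := by
  by_cases hP : lo κ ≤ x κ ∧ x κ < hi κ
  · have hx := clamp_inBox hlohi x
    have hxe : InBox lo hi (clamp lo hi x + e κ) := by rw [← clamp_add_e_of hP]; exact clamp_inBox hlohi _
    simp only [clampCfg, hP, and_self, if_true, clamp_add_e_of hP]
    exact h _ κ hx hxe
  · simp only [clampCfg, hP, if_false, clamp_add_e_of_not (hlohi κ) hP, cj_apply, Units.val_one, inv_one, one_mul,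
      mul_one, sub_self, norm_zero]
    exact hβ

omit [NormedAlgebra ℂ 𝔸] [CompleteSpace 𝔸] in
/-- The zero extension of the field given on the bonds of a box inherits the local bound `|B_b| ≤ b` globally. [folklore] -/
private theorem norm_insCfg_restr_le {B : Site d → Fin d → 𝔸} {b : ℝ} (hb : 0 ≤ b)
    (hB : ∀ (x : Site d) (κ : Fin d), InBox lo hi x → InBox lo hi (x + e κ) → ‖B x κ‖ ≤ b) (x : Site d) (κ : Fin d) :
    ‖insCfg (bondsIn lo hi) (restr (bondsIn lo hi) B) x κ‖ ≤ b := by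
  by_cases h : (x, κ) ∈ bondsIn lo hi
  · rw [B7Prop5Flat.insCfg_restr_of_mem _ _ h]
    obtain ⟨hx, hx'⟩ := B7Prop5Flat.mem_bondsIn.mp h
    exact hB x κ hx hx'
  · simp only [insCfg, h, dite_false, norm_zero]
    exact hb

end Clamp

/-! ## §2 The Lipschitz bound of (1.122)/(1.125) for the inductive `u₁` on the block tower, local hypotheses -/

section Local

variable {𝔸 : Type*} [NormedRing 𝔸] [NormOneClass 𝔸] [NormedAlgebra ℂ 𝔸] [CompleteSpace 𝔸]
variable {L : ℕ} {G : Subgroup 𝔸ˣ} {j : ℕ} {y : Site d} {U₀ : Site d → Fin d → 𝔸ˣ} {α₀ α₄ : ℝ} {B : Site d → Fin d → 𝔸} {c : ℝ}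
  {μ₁ μ₂ : Site d → 𝔸} {m : ℝ}

/-- **THE LIPSCHITZ BOUND OF (1.122)/(1.125) FOR THE INDUCTIVE `u₁`, LOCAL HYPOTHESES** (B8 p. 97 «|C′(λ − H′X₁) − C′(λ − H′X₂)| ≦
C′₂2B′₀(α₃ + α₄)|X₁ − X₂|», region-dependent form «on Ω_j»).  Setting: `L ≥ 2`, `G ⊂ U1` averaging-closed, `U₀` `G`-valued and
regular ON THE FINE BLOCK `Bʲ(y)` ONLY ((1.33) at level `j`), `U₁ = e^{B}` with (1.69) `|B_b| ≤ cL^{−j}` on the bonds of `Bʲ(y)`,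
`u₁ = glev … j 0` the gauge fixing (104)–(106) of [3] at top level `j`, site functions `μ₁, μ₂` in the half-size set (1.119) on `Bʲ(y)`
(`‖μᵢ(x)‖ < ½α₄`, `‖R(U₀(b))μᵢ(b₊) − μᵢ(b₋)‖ < ½α₄L^{−j}`) with `‖(μ₁ − μ₂)(x)‖ ≤ m`, `‖R(U₀(b))(μ₁ − μ₂)(b₊) − (μ₁ − μ₂)(b₋)‖ ≤ mL^{−j}`
there (`m ≥ 0`); the smallness of `B8Eq1115Concrete.eq214_local_B8` and of `lipschitz1122` (conditions on `α₀`, `c`, `α₄` alone).  THEN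
at every level-`m′` site `z` of the block `Bⁿ(y)` (`n + m′ = j`):
`‖C′_{m′}(u₁, μ₁)(z) − C′_{m′}(u₁, μ₂)(z)‖ ≤ C′₂·2m·(40d·c + α₄)·L^{m′}L^{−j}`.
[cite: Balaban1985RegularSpaces, (1.122)–(1.125) pp.96–97, (1.119) p.96, p.89 (paragraph after (1.76)); Balaban1985Averaging, Prop. 10 (213)–(214) p.50] -/
theorem lipschitz1122_local (hL : 2 ≤ L) (hG : AvgClosed d L G) (hU₀ : ∀ x κ, U₀ x κ ∈ G)
    (hα : 0 < α₀) (hα3 : C0 d * α₀ ≤ 1 / 3) (hα4 : 4 * α₀ ≤ c2' d L)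
    (h33 : pdevOn (tlo L y j) (thi L y j) U₀ < α₀ * (((L : ℝ) ^ j)⁻¹) ^ 2) (hc : 0 ≤ c)
    (h69 : ∀ (x : Site d) (κ : Fin d), InBox (tlo L y j) (thi L y j) x → InBox (tlo L y j) (thi L y j) (x + e κ) →
      ‖B x κ‖ ≤ c * ((L : ℝ) ^ j)⁻¹)
    (hsmall : Real.exp (4 * (800 * ((d : ℝ) + 1) ^ 2 * ((d : ℝ) + 4)) * α₀) * (1 + 8 * (131072 * ((d : ℝ) + 1) ^ 2) * c) ≤ 2)
    (hc₃ : 2 * c ≤ c3 d L) (hs : 128 * (d : ℝ) * c ≤ 1) (hL1 : 1 ≤ L)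
    (hα₄ : 0 < α₄) (hm : 0 ≤ m)
    (h₁b : ∀ x : Site d, InBox (tlo L y j) (thi L y j) x → ‖μ₁ x‖ < α₄ / 2)
    (h₁a : ∀ (x : Site d) (κ : Fin d), InBox (tlo L y j) (thi L y j) x → InBox (tlo L y j) (thi L y j) (x + e κ) →
      ‖cj (U₀ x κ) (μ₁ (x + e κ)) - μ₁ x‖ < α₄ / 2 * ((L : ℝ) ^ j)⁻¹)
    (h₂b : ∀ x : Site d, InBox (tlo L y j) (thi L y j) x → ‖μ₂ x‖ < α₄ / 2)
    (h₂a : ∀ (x : Site d) (κ : Fin d), InBox (tlo L y j) (thi L y j) x → InBox (tlo L y j) (thi L y j) (x + e κ) →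
      ‖cj (U₀ x κ) (μ₂ (x + e κ)) - μ₂ x‖ < α₄ / 2 * ((L : ℝ) ^ j)⁻¹)
    (hmb : ∀ x : Site d, InBox (tlo L y j) (thi L y j) x → ‖(μ₁ - μ₂) x‖ ≤ m)
    (hma : ∀ (x : Site d) (κ : Fin d), InBox (tlo L y j) (thi L y j) x → InBox (tlo L y j) (thi L y j) (x + e κ) →
      ‖cj (U₀ x κ) ((μ₁ - μ₂) (x + e κ)) - (μ₁ - μ₂) x‖ ≤ m * ((L : ℝ) ^ j)⁻¹)
    (hα₃' : 40 * d * c ≤ 1 / 200) (hs₁ : 200 * C6 d * α₄ ≤ 1) (hs₂ : 12000 * ((d : ℝ) + 1) * L * α₄ ≤ 1)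
    (hs₃ : C4G d L * (α₀ + 40 * d * c + 4 * α₄) ≤ 1)
    (hs₄ : 1024 * ((d : ℝ) + 1) * ((d : ℝ) + 4) * L ^ 2 * α₀ ≤ 1) (hs₅ : 32 * ((d : ℝ) + 1) ^ 2 * C6 d * L ^ 2 * α₀ ≤ 1)
    (hs₆ : 16 * d * B7Prop9Flat.C5' d * C6 d * (L : ℝ) ^ 2 * α₀ ≤ 1) (hs₇ : 8 * d * C6 d * L * α₀ ≤ 1)
    {m' n : ℕ} (hmn : n + m' = j) (z : Site d) (hz : tlo L y n ≤ z) (hz' : z ≤ thi L y n) :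
    ‖Cnl L U₀ (glev L hL1 U₀ (expCfg B) j 0) m' μ₁ z - Cnl L U₀ (glev L hL1 U₀ (expCfg B) j 0) m' μ₂ z‖
      ≤ C2p d * (2 * m) * (40 * d * c + α₄) * ((L : ℝ) ^ m' * ((L : ℝ) ^ j)⁻¹) := by
  have hlohi : ∀ i, tlo L y j i ≤ thi L y j i := B8Ineq130.tlo_le_thi hL1 le_rfl j
  have hUU : ∀ x κ, U₀ x κ ∈ U1 𝔸 := fun x κ => hG.le_U1 (hU₀ x κ)
  have hLj : (0 : ℝ) < (L : ℝ) ^ j := by positivity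
  -- the extended data
  set U₀c := clampCfg (tlo L y j) (thi L y j) U₀ with hU₀c_def
  set Bc := insCfg (bondsIn (tlo L y j) (thi L y j)) (restr (bondsIn (tlo L y j) (thi L y j)) B) with hBc_def
  set μ₁c : Site d → 𝔸 := fun x => μ₁ (clamp (tlo L y j) (thi L y j) x) with hμ₁c_def
  set μ₂c : Site d → 𝔸 := fun x => μ₂ (clamp (tlo L y j) (thi L y j) x) with hμ₂c_def
  have hU₀c : ∀ x κ, U₀c x κ ∈ G := clampCfg_mem hU₀
  have h52c : pdev U₀c < α₀ * (((L : ℝ) ^ j)⁻¹) ^ 2 := (pdev_clampCfg_le hlohi hUU).trans_lt h33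
  -- the field bound in `B7Eq167General`'s letters: `|Bc| ≤ b`, `b = c·L^{−j}`, `Lʲb = c`
  have hb : 0 ≤ c * ((L : ℝ) ^ j)⁻¹ := by positivity
  have hkey : (L : ℝ) ^ j * (c * ((L : ℝ) ^ j)⁻¹) = c := by field_simp
  have hBc : ∀ x κ, ‖Bc x κ‖ ≤ c * ((L : ℝ) ^ j)⁻¹ := norm_insCfg_restr_le hb h69
  have h₀ : AgreeOn (tlo L y j) (thi L y j) U₀ U₀c := (clampCfg_agree U₀).symm
  have h₁ : AgreeOn (tlo L y j) (thi L y j) (expCfg B) (expCfg Bc) :=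
    B7Prop5Flat.agreeOn_expCfg (B7Prop5Flat.agreeOn_insCfg_restr _ _ B)
  -- the global (1.119)-type hypotheses for the clamped site functions
  have hβ : 0 < α₄ / 2 * ((L : ℝ) ^ j)⁻¹ := by positivity
  have h₁bc : ∀ x : Site d, ‖μ₁c x‖ < α₄ / 2 := hb_clamp hlohi h₁b
  have h₂bc : ∀ x : Site d, ‖μ₂c x‖ < α₄ / 2 := hb_clamp hlohi h₂b
  have h₁ac : ∀ (x : Site d) (κ : Fin d), ‖cj (U₀c x κ) (μ₁c (x + e κ)) - μ₁c x‖ < α₄ / 2 * ((L : ℝ) ^ j)⁻¹ :=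
    ha_clamp hlohi hβ h₁a
  have h₂ac : ∀ (x : Site d) (κ : Fin d), ‖cj (U₀c x κ) (μ₂c (x + e κ)) - μ₂c x‖ < α₄ / 2 * ((L : ℝ) ^ j)⁻¹ :=
    ha_clamp hlohi hβ h₂a
  have hdiff : (μ₁c - μ₂c) = fun x => (μ₁ - μ₂) (clamp (tlo L y j) (thi L y j) x) := by
    funext x; simp only [hμ₁c_def, hμ₂c_def, Pi.sub_apply]
  have hmbc : ∀ x : Site d, ‖(μ₁c - μ₂c) x‖ ≤ m := by
    intro x; rw [hdiff]; exact hb_clamp_le hlohi hmb x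
  have hmac : ∀ (x : Site d) (κ : Fin d), ‖cj (U₀c x κ) ((μ₁c - μ₂c) (x + e κ)) - (μ₁c - μ₂c) x‖ ≤ m * ((L : ℝ) ^ j)⁻¹ := by
    intro x κ; rw [hdiff]; exact ha_clamp_le hlohi (by positivity) hma x κ
  -- `u₁ᶜ ∈ Λ_j(U₀ᶜ, 40d·c)` globally ([3] (166)/(167) for the clamped data)
  have hΛ := inLambda_glev_general hL hG hU₀c hα hα3 hα4 h52c hb hBc (by rw [hkey]; exact hsmall) (by rw [hkey]; exact hc₃)
    (by rw [hkey]; exact hs) hL1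
  rw [hkey] at hΛ
  have hα₃ : (0 : ℝ) ≤ 40 * d * c := by positivity
  have hα2 : 2 * α₀ ≤ c2' d L := by linarith
  -- the GLOBAL Lipschitz bound for the clamped data, `k ↦ j`
  have hglob := lipschitz1122 hL hG hU₀c μ₁c μ₂c hα hα3 hα2 h52c h₁ac h₁bc h₂ac h₂bc hmac hmbc hΛ hα₃ hα₃' hs₁ hs₂ hs₃
    hs₄ hs₅ hs₆ hs₇ m' (by omega) z
  -- transfer to the original data on the tower
  have hu₁ : ∀ x : Site d, tlo L y j ≤ x → x ≤ thi L y j →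
      glev L hL1 U₀ (expCfg B) j 0 x = glev L hL1 U₀c (expCfg Bc) j 0 x :=
    glev_congr_tower hL1 h₀ h₁ j 0 (by omega)
  have hC : ∀ {μ μc : Site d → 𝔸}, (∀ x : Site d, tlo L y j ≤ x → x ≤ thi L y j → μ x = μc x) →
      Cnl L U₀ (glev L hL1 U₀ (expCfg B) j 0) m' μ z = Cnl L U₀c (glev L hL1 U₀c (expCfg Bc) j 0) m' μc z := by
    intro μ μc hμ
    have hu' : ∀ x : Site d, tlo L y j ≤ x → x ≤ thi L y j → (fun x => expUnit (μ x)) x = (fun x => expUnit (μc x)) x :=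
      fun x hx hx' => by simp only [hμ x hx hx']
    simp only [Cnl, Qnl_eq_mlog_utilG]
    rw [qprimeIter_bgT_eq_lamAvgG L U₀ μ m', qprimeIter_bgT_eq_lamAvgG L U₀c μc m',
      utilG_congr_tower hL1 h₀ hu' hu₁ m' n hmn z hz hz', lamAvgG_congr_tower hL1 h₀ hμ m' n hmn z hz hz']
  have hμ₁ : ∀ x : Site d, tlo L y j ≤ x → x ≤ thi L y j → μ₁ x = μ₁c x :=
    fun x hx hx' => by simp only [hμ₁c_def, lam_clamp_eq (inBox_of_le hx hx')]
  have hμ₂ : ∀ x : Site d, tlo L y j ≤ x → x ≤ thi L y j → μ₂ x = μ₂c x :=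
    fun x hx hx' => by simp only [hμ₂c_def, lam_clamp_eq (inBox_of_le hx hx')]
  rw [hC hμ₁, hC hμ₂]
  exact hglob

end Local

#print axioms lipschitz1122_local

end Literature.MathematicalPhysics.QuantumFieldTheory.Balaban1983to89.B8Eq1122Local

end
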